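import Literature.AnabelianGeometry.SemiGraphs.TemperedVerticialInjective
import Literature.AnabelianGeometry.SemiGraphs.TemperedCoveringsSubgraphBTemp
import Literature.AnabelianGeometry.SemiGraphs.UniversalCoveringObj
import Literature.AnabelianGeometry.SemiGraphs.CoveringComponent
import HarnessLib

/-!
# Finite coverings of a sub-semi-graph are split by restrictions of finite coverings ([SemiAnbd] Prop. 2.5 (i),
# first reduction; §3 Def. 3.5 (ii))

Mochizuki, *Semi-graphs of anabelioids*, Publ. RIMS **42** (2006), §2, Proposition 2.5 (i) p. 27, proof:
"it suffices to show that any finite étale covering of `𝒢_ℍ` may be split by a finite étale covering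
pulled back from `𝒢` … by our assumption of quasi-coherence, it suffices to construct … a finite étale
covering of `𝒢` each of whose constituent anabelioids is trivial" [cite: MochizukiSemiAnbd2006, Prop 2.5(i) p.27];
§3 Def. 3.5 (ii) p. 37 (splitting, temperedness) [cite: MochizukiSemiAnbd2006, Def 3.5(ii) p.37]; used at
[IUTchI] §2 p. 44 l. 39–44 (the decomposition groups `Π^tp_ℍ ⊆ Π^tp_𝔾`, "inclusions … of topological
groups") [cite: Mochizuki2012, IUTchI §2 p.44].

PROOF-ONLY file (abc-iut cell, layer L3, row «DECOMP-EMB», the finite residual (FIN) displayed by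
abc-iut-L3-d1's `dom_of_finiteRestrictSplits` (`TemperedDominationOfRestriction.lean`) as the hypothesis
`hfin`; seat abc-iut-w4-d052 gen 5).  In the SPLITTING currency of Def. 3.5 (ii) the gluing step of the
printed proof is not needed: for `𝒢` QUASI-COHERENT (Def. 2.3 (iii), `IsQuasiCoherent`) and a sub-semi-graph
`ℍ`, feed the constituents `F′_c` (`c ∈ ℍ`) of a finite covering `F′` of `𝒢_ℍ` — one-point coverings
(`BTemp.trivialObj`) at the other constituents, bound `M` = the common fibre cardinality — to
quasi-coherence; the resulting approximator `A : 𝒢 → 𝒢′` has kernels acting trivially on the `F′_c`, and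
the point stabilisers of its TRIVIALISING COVERING `A.trivCov` (abc-iut-L3's
`TemperedVerticialInjective.lean`: finite, nonempty fibres, tempered) are exactly those kernels
(`Approximator.objV_ρ`), so `trivCov|_ℍ` SPLITS `F′`.

* `CovObj.natCard_SE_edgeOf_eq`, `natCard_node_eq_of_isConnected`, `natCard_SV_eq_natCard_SV`,
  `natCard_SE_eq_natCard_SV`, `natCard_SE_eq_natCard_SE`, `exists_card_le_of_isConnected` — on a CONNECTED
  semi-graph the fibres of a covering are equicardinal (walk induction on the barycentric subdivision,
  steps = the gluing bijections `S_e ≅ b^* S_v`);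
* `CovObj.Splits.trans_of_hasNonemptyFibres` — splitting is transitive through nonempty fibres;
* **`exists_finite_covRestrict_splits_of_card_le`** — the construction (bounded fibres, any `ℍ`);
* **`finiteRestrictSplits`** — (FIN) VERBATIM: `∀ F′ : CovObj (𝒢.restrict H), F′.IsFinite →
  F′.HasNonemptyFibres → ∃ S : CovObj 𝒢, S.IsFinite ∧ S.HasNonemptyFibres ∧
  ((𝒢.covRestrict H).obj S).Splits F′`, for `𝒢` quasi-coherent and `ℍ` connected (+ `_tempered`); both
  hypotheses are projections of the consumers' bundles: `hqc := h37.isQuasiCoherent` for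
  `h37 : 𝒢.Thm37Hypotheses` and `hH := h37H.isConnected` for `h37H : (𝒢.restrict H).Thm37Hypotheses`
  (fields of `Prop36Hypotheses`, which `Thm37Hypotheses` extends);
* `exists_finite_covRestrict_splits_component` / `exists_finite_covRestrict_splitsAt` — the same for the
  connected components of a TEMPERED covering of `𝒢_ℍ` (Def. 3.5 (ii)).

With abc-iut-L3-d1's `dom_of_finiteRestrictSplits` (p474772) and abc-iut-w4-d052's
`IsDecompHom.isInducing_of_dom` (p471772) this closes the embedding hypothesis of the decomposition
homomorphism `Π^tp_ℍ → Π^tp_𝔾` for `𝒢` countable, Galois-countable and quasi-coherent and `ℍ` connected.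
NOT here: the INJECTIVITY statement of Prop. 2.5 (i) itself in this presentation (that needs the printed
gluing; it is `piHToPi_injective` on the `SemiGraphOfAnabelioids` side).  Theorems only, no `def`, no
instance; nothing here takes a side on [IUTchIII] Cor. 3.12.
-/

namespace Literature.AnabelianGeometry.SemiGraphs

namespace ProfiniteSemiGraph

open CategoryTheory

universe u

variable {𝒢 : ProfiniteSemiGraph.{u}}

/-! ### Fibre cardinalities of a covering are constant on a connected semi-graph -/

/-- Along an abutting branch the fibres `S_e`, `S_v` are in bijection (the gluing `S_e ≅ b^* S_v`).
[cite: MochizukiSemiAnbd2006, §3 p.36] -/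
theorem CovObj.natCard_SE_edgeOf_eq (S : CovObj 𝒢) (b : 𝒢.graph.Branch) (v : 𝒢.graph.Vertex)
    (h : 𝒢.graph.abuts b = some v) :
    Nat.card (S.SE (𝒢.graph.edgeOf b)).obj.V = Nat.card (S.SV v).obj.V :=
  Nat.card_congr
    (((temperedAction (𝒢.Ge (𝒢.graph.edgeOf b))).ι ⋙ Action.forget (Type u) _).mapIso
      (S.glue b v h)).toEquiv

/-- On a CONNECTED semi-graph the fibre cardinality of a covering — read at a node of the barycentric
subdivision (vertex, edge, or branch ↦ its edge) — is the same at all nodes (induction along walks;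
the steps are the gluing bijections). [cite: MochizukiSemiAnbd2006, §3 p.36] -/
theorem CovObj.natCard_node_eq_of_isConnected (hc : 𝒢.graph.IsConnected) (S : CovObj 𝒢)
    (a b : 𝒢.graph.Node) :
    Sum.elim (fun v => Nat.card (S.SV v).obj.V) (Sum.elim (fun e => Nat.card (S.SE e).obj.V)
      (fun b => Nat.card (S.SE (𝒢.graph.edgeOf b)).obj.V)) a =
    Sum.elim (fun v => Nat.card (S.SV v).obj.V) (Sum.elim (fun e => Nat.card (S.SE e).obj.V)
      (fun b => Nat.card (S.SE (𝒢.graph.edgeOf b)).obj.V)) b := by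
  -- the fibre cardinality at a node
  let f : 𝒢.graph.Node → ℕ := Sum.elim (fun v => Nat.card (S.SV v).obj.V)
    (Sum.elim (fun e => Nat.card (S.SE e).obj.V) (fun b => Nat.card (S.SE (𝒢.graph.edgeOf b)).obj.V))
  show f a = f b
  have hadj : ∀ a b : 𝒢.graph.Node, 𝒢.graph.subdivision.Adj a b → f a = f b := by
    intro a b hab
    rw [SemiGraph.subdivision, SimpleGraph.fromRel_adj] at hab
    have key : ∀ a b : 𝒢.graph.Node, 𝒢.graph.NodeRel a b → f a = f b := by
      intro a b hr
      cases hr with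
      | edge_branch b => rfl
      | branch_vertex b v h => exact S.natCard_SE_edgeOf_eq b v h
    rcases hab.2 with h | h
    · exact key a b h
    · exact (key b a h).symm
  have hreach : ∀ a b : 𝒢.graph.Node, 𝒢.graph.subdivision.Reachable a b → f a = f b := by
    intro a b ⟨p⟩
    induction p with
    | nil => rfl
    | cons had _ ih => exact (hadj _ _ had).trans ih
  exact hreach a b (hc.connected.preconnected _ _)

/-- On a CONNECTED semi-graph all vertex fibres of a covering have the same cardinality.
[cite: MochizukiSemiAnbd2006, §3 p.36] -/
theorem CovObj.natCard_SV_eq_natCard_SV (hc : 𝒢.graph.IsConnected) (S : CovObj 𝒢)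
    (v w : 𝒢.graph.Vertex) : Nat.card (S.SV v).obj.V = Nat.card (S.SV w).obj.V :=
  S.natCard_node_eq_of_isConnected hc (Sum.inl v) (Sum.inl w)

/-- … edge fibres versus vertex fibres. [cite: MochizukiSemiAnbd2006, §3 p.36] -/
theorem CovObj.natCard_SE_eq_natCard_SV (hc : 𝒢.graph.IsConnected) (S : CovObj 𝒢)
    (e : 𝒢.graph.Edge) (w : 𝒢.graph.Vertex) : Nat.card (S.SE e).obj.V = Nat.card (S.SV w).obj.V :=
  S.natCard_node_eq_of_isConnected hc (Sum.inr (Sum.inl e)) (Sum.inl w)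

/-- … and edge fibres among themselves. [cite: MochizukiSemiAnbd2006, §3 p.36] -/
theorem CovObj.natCard_SE_eq_natCard_SE (hc : 𝒢.graph.IsConnected) (S : CovObj 𝒢)
    (e e' : 𝒢.graph.Edge) : Nat.card (S.SE e).obj.V = Nat.card (S.SE e').obj.V :=
  S.natCard_node_eq_of_isConnected hc (Sum.inr (Sum.inl e)) (Sum.inr (Sum.inl e'))

/-- Splitting is transitive through a covering with nonempty fibres: if `F` splits `S`, `S` has
nonempty fibres and `S` splits `T`, then `F` splits `T`. [cite: MochizukiSemiAnbd2006, Def 3.5(ii) p.37] -/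
theorem CovObj.Splits.trans_of_hasNonemptyFibres {F S T : CovObj 𝒢} (hFS : F.Splits S)
    (hS : S.HasNonemptyFibres) (hST : S.Splits T) : F.Splits T := by
  refine ⟨fun v x g hx t => ?_, fun e x g hx t => ?_⟩
  · obtain ⟨y⟩ := hS.nonempty_V v
    exact hST.1 v y g (hFS.1 v x g hx y) t
  · obtain ⟨y⟩ := hS.nonempty_E e
    exact hST.2 e y g (hFS.2 e x g hx y) t

/-! ### (DOM-fin): a finite covering of `𝒢` whose restriction to `ℍ` splits a given finite covering of `𝒢_ℍ` -/

/-- **Quasi-coherence ⇒ finite coverings of `𝒢_ℍ` are split by restrictions of finite coverings of `𝒢`**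
([SemiAnbd] Prop. 2.5 (i), proof p. 27: "it suffices to show that any finite étale covering of `𝒢_ℍ` may
be split by a finite étale covering pulled back from `𝒢` … by our assumption of quasi-coherence, it
suffices to construct … a finite étale covering of `𝒢` each of whose constituent anabelioids is trivial"
— the tree's trivialising covering `Approximator.trivCov`), bounded form: for `𝒢` quasi-coherent, any
sub-semi-graph `ℍ` and any `Y ∈ B^cov(𝒢_ℍ)` with finite fibres of cardinality `≤ M` (`0 < M`), there is a
FINITE TEMPERED covering `X` of `𝒢` with nonempty fibres whose restriction `X|_ℍ` SPLITS `Y`: quasi-coherence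
applied to the constituents `Y_c` (`c ∈ ℍ`; one-point coverings elsewhere) yields an approximator `𝒢 → 𝒢′`
whose kernels act trivially on the `Y_c`, and the point stabilisers of its trivialising covering ARE those
kernels. [cite: MochizukiSemiAnbd2006, Prop 2.5(i) p.27] -/
theorem exists_finite_covRestrict_splits_of_card_le (hqc : 𝒢.IsQuasiCoherent)
    (H : 𝒢.graph.Subgraph) (Y : CovObj (𝒢.restrict H)) {M : ℕ} (hM : 0 < M)
    (hYV : ∀ v, Finite (Y.SV v).obj.V ∧ Nat.card (Y.SV v).obj.V ≤ M)
    (hYE : ∀ e, Finite (Y.SE e).obj.V ∧ Nat.card (Y.SE e).obj.V ≤ M) :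
    ∃ X : CovObj 𝒢, X.IsFinite ∧ X.HasNonemptyFibres ∧ X.IsTempered ∧
      ((𝒢.covRestrict H).obj X).Splits Y := by
  classical
  -- the families fed to quasi-coherence: `Y_c` over `ℍ`, one point elsewhere
  let HV : ∀ v : 𝒢.graph.Vertex, BTemp (𝒢.Gv v) := fun v =>
    if h : v ∈ H.verts then Y.SV ⟨v, h⟩ else BTemp.trivialObj (𝒢.Gv v) PUnit
  let HE : ∀ e : 𝒢.graph.Edge, BTemp (𝒢.Ge e) := fun e =>
    if h : e ∈ H.edges then Y.SE ⟨e, h⟩ else BTemp.trivialObj (𝒢.Ge e) PUnit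
  have hHV : ∀ v, Nat.card (HV v).obj.V ≤ M ∧ Finite (HV v).obj.V := by
    intro v
    by_cases h : v ∈ H.verts
    · simp only [HV, dif_pos h]
      exact ⟨(hYV ⟨v, h⟩).2, (hYV ⟨v, h⟩).1⟩
    · simp only [HV, dif_neg h]
      exact ⟨by simpa [BTemp.trivialObj] using (show 1 ≤ M from hM), inferInstanceAs (Finite PUnit)⟩
  have hHE : ∀ e, Nat.card (HE e).obj.V ≤ M ∧ Finite (HE e).obj.V := by
    intro e
    by_cases h : e ∈ H.edges
    · simp only [HE, dif_pos h]
      exact ⟨(hYE ⟨e, h⟩).2, (hYE ⟨e, h⟩).1⟩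
    · simp only [HE, dif_neg h]
      exact ⟨by simpa [BTemp.trivialObj] using (show 1 ≤ M from hM), inferInstanceAs (Finite PUnit)⟩
  obtain ⟨A, hAV, hAE⟩ := hqc M HV HE hHV hHE
  obtain ⟨MA, hMA, hdvd⟩ := A.bounded
  refine ⟨A.trivCov hMA hdvd, A.trivCov_isFinite hMA hdvd, A.trivCov_hasNonemptyFibres hMA hdvd,
    A.trivCov_isTempered hMA hdvd, ?_, ?_⟩
  · -- vertices of `ℍ`
    intro v x g hx s
    have hg : A.πV v.1 g = 1 := by
      change (A.πV v.1 g * x.1, x.2) = x at hx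
      rw [Prod.ext_iff, and_iff_left rfl] at hx
      exact mul_eq_right.mp hx
    have hv : HV v.1 = Y.SV v := by
      simp only [HV, dif_pos v.2]
      rfl
    have key : ∀ Z : BTemp (𝒢.Gv v.1), Z = HV v.1 → ∀ z : Z.obj.V, Z.obj.ρ g z = z := by
      intro Z hZ
      subst hZ
      exact hAV v.1 g hg
    exact key (Y.SV v) hv.symm s
  · -- edges of `ℍ`
    intro e x g hx s
    have hg : A.πE e.1 g = 1 := by
      change (A.πE e.1 g * x.1, x.2) = x at hx
      rw [Prod.ext_iff, and_iff_left rfl] at hx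
      exact mul_eq_right.mp hx
    have he : HE e.1 = Y.SE e := by
      simp only [HE, dif_pos e.2]
      rfl
    have key : ∀ Z : BTemp (𝒢.Ge e.1), Z = HE e.1 → ∀ z : Z.obj.V, Z.obj.ρ g z = z := by
      intro Z hZ
      subst hZ
      exact hAE e.1 g hg
    exact key (Y.SE e) he.symm s

/-- A uniform bound for the fibres of a finite covering with nonempty fibres of a CONNECTED semi-graph:
all fibres have the cardinality `M ≥ 1` of the fibre at any node. [cite: MochizukiSemiAnbd2006, §3 p.36] -/
theorem CovObj.exists_card_le_of_isConnected (hc : 𝒢.graph.IsConnected) (F : CovObj 𝒢)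
    (hFfin : F.IsFinite) (hFne : F.HasNonemptyFibres) :
    ∃ M : ℕ, 0 < M ∧ (∀ v, Finite (F.SV v).obj.V ∧ Nat.card (F.SV v).obj.V ≤ M) ∧
      ∀ e, Finite (F.SE e).obj.V ∧ Nat.card (F.SE e).obj.V ≤ M := by
  obtain ⟨n⟩ := hc.connected.nonempty
  refine ⟨Sum.elim (fun v => Nat.card (F.SV v).obj.V) (Sum.elim (fun e => Nat.card (F.SE e).obj.V)
      (fun b => Nat.card (F.SE (𝒢.graph.edgeOf b)).obj.V)) n, ?_,
    fun v => ⟨hFfin.finite_V v, ?_⟩, fun e => ⟨hFfin.finite_E e, ?_⟩⟩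
  · rcases n with v₀ | e₀ | b₀
    · haveI := hFfin.finite_V v₀
      haveI := hFne.nonempty_V v₀
      exact Nat.card_pos
    · haveI := hFfin.finite_E e₀
      haveI := hFne.nonempty_E e₀
      exact Nat.card_pos
    · haveI := hFfin.finite_E (𝒢.graph.edgeOf b₀)
      haveI := hFne.nonempty_E (𝒢.graph.edgeOf b₀)
      exact Nat.card_pos
  · exact (F.natCard_node_eq_of_isConnected hc (Sum.inl v) n).le
  · exact (F.natCard_node_eq_of_isConnected hc (Sum.inr (Sum.inl e)) n).le

/-- **(FIN) — the displayed finite residual of row «DECOMP-EMB» (abc-iut-L3-d1's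
`dom_of_finiteRestrictSplits`, hypothesis `hfin`), PROVED for `𝒢` quasi-coherent and `ℍ` connected**:
every finite covering `F′` of `𝒢_ℍ` with nonempty fibres is SPLIT by the restriction `S|_ℍ` of a finite
covering `S` of `𝒢` with nonempty fibres ([SemiAnbd] Prop. 2.5 (i), proof p. 27, first reduction + the
trivialising covering of an approximator; no gluing is needed for SPLITTING, only for a morphism).
[cite: MochizukiSemiAnbd2006, Prop 2.5(i) p.27] -/
theorem finiteRestrictSplits (hqc : 𝒢.IsQuasiCoherent) (H : 𝒢.graph.Subgraph)
    (hH : (𝒢.restrict H).graph.IsConnected) :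
    ∀ F' : CovObj (𝒢.restrict H), F'.IsFinite → F'.HasNonemptyFibres →
      ∃ S : CovObj 𝒢, S.IsFinite ∧ S.HasNonemptyFibres ∧ ((𝒢.covRestrict H).obj S).Splits F' := by
  intro F' hF'fin hF'ne
  obtain ⟨M, hM, hV, hE⟩ := F'.exists_card_le_of_isConnected hH hF'fin hF'ne
  obtain ⟨X, hXfin, hXne, -, hXspl⟩ := exists_finite_covRestrict_splits_of_card_le hqc H F' hM hV hE
  exact ⟨X, hXfin, hXne, hXspl⟩

/-- (FIN) with the splitting covering TEMPERED as well (it is the trivialising covering of an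
approximator, split by itself). [cite: MochizukiSemiAnbd2006, Prop 2.5(i) p.27] -/
theorem finiteRestrictSplits_tempered (hqc : 𝒢.IsQuasiCoherent) (H : 𝒢.graph.Subgraph)
    (hH : (𝒢.restrict H).graph.IsConnected) (F' : CovObj (𝒢.restrict H)) (hF'fin : F'.IsFinite)
    (hF'ne : F'.HasNonemptyFibres) :
    ∃ S : CovObj 𝒢, S.IsFinite ∧ S.HasNonemptyFibres ∧ S.IsTempered ∧
      ((𝒢.covRestrict H).obj S).Splits F' := by
  obtain ⟨M, hM, hV, hE⟩ := F'.exists_card_le_of_isConnected hH hF'fin hF'ne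
  exact exists_finite_covRestrict_splits_of_card_le hqc H F' hM hV hE
/-- **(DOM-fin) for components of tempered coverings of `𝒢_ℍ`** (the displayed finite residual `hfin` of
row «DECOMP-EMB» part (C)): for `𝒢` quasi-coherent and `ℍ` a CONNECTED sub-semi-graph, every connected
component of a tempered covering `T` of `𝒢_ℍ` is SPLIT by the restriction `X|_ℍ` of some finite tempered
covering `X` of `𝒢` with nonempty fibres — the finite covering `F′` of `𝒢_ℍ` splitting the component
(Def. 3.5 (ii)) has fibres of one cardinality `M ≥ 1` (connectedness), so
`exists_finite_covRestrict_splits_of_card_le` applies, and splitting is transitive through `F′`.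
[cite: MochizukiSemiAnbd2006, Prop 2.5(i) p.27] -/
theorem exists_finite_covRestrict_splits_component (hqc : 𝒢.IsQuasiCoherent) (H : 𝒢.graph.Subgraph)
    (hH : (𝒢.restrict H).graph.IsConnected) (T : CovObj (𝒢.restrict H)) (hT : T.IsTempered)
    (p : T.Point) :
    ∃ X : CovObj 𝒢, X.IsFinite ∧ X.HasNonemptyFibres ∧ X.IsTempered ∧
      ((𝒢.covRestrict H).obj X).Splits (T.component p) := by
  obtain ⟨F, hFfin, hFne, hFspl⟩ := T.exists_splits_component p hT
  -- one bound `M ≥ 1` for all fibres of `F`: the cardinality at the node under `p`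
  obtain ⟨M, hM, hV, hE⟩ := F.exists_card_le_of_isConnected hH hFfin hFne
  obtain ⟨X, hXfin, hXne, hXt, hXspl⟩ := exists_finite_covRestrict_splits_of_card_le hqc H F hM hV hE
  exact ⟨X, hXfin, hXne, hXt, hXspl.trans_of_hasNonemptyFibres hFne hFspl⟩

/-- The same at every POINT of the component (the `SplitsAt` currency of Def. 3.5 (ii)).
[cite: MochizukiSemiAnbd2006, Def 3.5(ii) p.37] -/
theorem exists_finite_covRestrict_splitsAt (hqc : 𝒢.IsQuasiCoherent) (H : 𝒢.graph.Subgraph)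
    (hH : (𝒢.restrict H).graph.IsConnected) (T : CovObj (𝒢.restrict H)) (hT : T.IsTempered)
    (p : T.Point) :
    ∃ X : CovObj 𝒢, X.IsFinite ∧ X.HasNonemptyFibres ∧ X.IsTempered ∧
      ∀ q : T.Point, T.SameComponent p q → ((𝒢.covRestrict H).obj X).SplitsAt T q := by
  obtain ⟨F, hFfin, hFne, hFspl⟩ := hT p
  obtain ⟨M, hM, hV, hE⟩ := F.exists_card_le_of_isConnected hH hFfin hFne
  obtain ⟨X, hXfin, hXne, hXt, hXspl⟩ := exists_finite_covRestrict_splits_of_card_le hqc H F hM hV hE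
  refine ⟨X, hXfin, hXne, hXt, fun q hpq => ?_⟩
  rcases q with ⟨v, t⟩ | ⟨e, t⟩
  · intro x g hx
    obtain ⟨y⟩ := hFne.nonempty_V v
    exact hFspl (Sum.inl ⟨v, t⟩) hpq y g (hXspl.1 v x g hx y)
  · intro x g hx
    obtain ⟨y⟩ := hFne.nonempty_E e
    exact hFspl (Sum.inr ⟨e, t⟩) hpq y g (hXspl.2 e x g hx y)


end ProfiniteSemiGraph

end Literature.AnabelianGeometry.SemiGraphs
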